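import Summits.MatrixMultiplication.MatrixMultiplication.Theorems.ObstructionDescentSecantGeneration

/- `set_option linter.dupNamespace false` as in the sibling kernel files (namespace `…Theorems.<FileStem>`). -/
set_option linter.dupNamespace false

/-!
# The sub-format obstruction to cutting out secants in low degree (decomp-mm · lens 3 · gen 20 · negative side of `G₁`)

Route `route-MatrixMultiplication-ObstructionDescent`.  The exact degree-generation law `G₁` «`σ_m(ℂ^m⊗ℂ^m⊗ℂ^m)` is cut
out set-theoretically by its equations of degree `≤ m^c`» (spelled raw in
`ObstructionDescentSecantGeneration.secantsCutOut_raw_iff`) is calibrated from BELOW by every sub-format: this file proves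
the elementary RESTRICTION LEMMA behind that calibration.

* `aeval_bind₁_subformatPullback`: the pull-back of a format-`m` polynomial `f` along the zero-padding
  `(ℂ^N)^{⊗3} ↪ (ℂ^m)^{⊗3}` induced by an injection `e : Fin N → Fin m` is a polynomial on the sub-format, of no larger
  degree (`totalDegree_subformatPullback_le`), whose value at `s` is `f(pad_e s)`;
* `subformatPullback_vanishing`: if `f` vanishes on the rank-`≤ m` tensors of format `m` (a «test of `σ_m`»), its pull-back
  vanishes on the rank-`≤ m` tensors of format `N`;
* **`not_testsDecide_of_subformatWitness`**: if some `s₀` of format `N ≤ m` has border rank `> m` but is annihilated by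
  every degree-`≤ D` polynomial on `(ℂ^N)^{⊗3}` vanishing on rank-`≤ m` tensors (i.e. `I(σ_m((ℂ^N)^{⊗3}))` has no element of
  degree `≤ D` separating `s₀`), then the degree-`≤ D` tests of `σ_m(ℂ^m⊗ℂ^m⊗ℂ^m)` do NOT decide border rank `≤ m`:
  the CUT-OUT DEGREE `D₀(m)` of `σ_m` in format `m` is `> D`;
* `subformatSeparates_of_testsDecide` (contrapositive, positive form) and `subformatSeparates_of_secantsCutOut`: under
  `G₁` every sub-format witness of border rank `> m` is separated from `σ_m((ℂ^N)^{⊗3})` in degree `≤ m^c`, eventually;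
* `subformatSeparates_of_secantTestsSoundUpToPolyLoss`: the same calibration of the FILED law `G₃` (route decl
  `SecantTestsSoundUpToPolyLoss`): witnesses of border rank `> m^{1+δ}` in any sub-format are separated in degree `≤ m^c`.

APPLICATION (informal, the data are numerical theorems in print): `σ_18(ℂ^7⊗ℂ^7⊗ℂ^7)` is a hypersurface and
`I_{186999}(σ_18(ℂ^7⊗ℂ^7⊗ℂ^7)) = 0` (Hauenstein–Ikenmeyer–Landsberg 2013; Landsberg 2017, §8.3.2), so with `N = 7`,
`m = 18`, `D = 186999` and `s₀` generic (`bR = 19`) the theorem gives `D₀(18) ≥ 187000 ≥ 18^{4.2}`; likewise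
`D₀(6) ≥ 19` from `σ_6(ℂ^4⊗ℂ^4⊗ℂ^4)` and `D₀(15) ≥ 46` from `σ_15(ℂ^4⊗ℂ^8⊗ℂ^9)`.  Expected-hypersurface sub-formats
(`m(N₁+N₂+N₃−2) = N₁N₂N₃−1`) exist for 75 values `m ≤ 120`, which is why `G₁` is expected to FAIL and only the lossy
law `G₃ = SecantTestsSoundUpToPolyLoss` was filed (the witnesses have border rank `≤ m+1`, so they do not touch `G₃`).

No `def`; the pull-back substitution is spelled inline.
[cite: BurgisserIkenmeyer2011, §2 (zero-padding), §3.1; Blaser2013, Def. 6.1, Lemma 5.4; LandsbergGCT2017, §8.3.2;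
HauensteinIkenmeyerLandsberg2013]
-/

noncomputable section

open scoped BigOperators
open Finset

namespace Summit.MatrixMultiplication.MatrixMultiplication.Theorems.ObstructionDescentSubformatObstruction

open Literature.Computability.AlgebraicComplexity (tensorRank unitTensor algBorderRank algBorderRank_precomp_le)
open Summit.MatrixMultiplication.MatrixMultiplication.Theorems.ObstructionCalculus
open Summit.MatrixMultiplication.MatrixMultiplication.Theorems.ObstructionDescentCornerEquations
  (totalDegree_bind₁_le_of_le_one tensorRank_padTensor_le)
open Summit.MatrixMultiplication.MatrixMultiplication.Theorems.ObstructionDescentSecantGeneration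

variable {m N : ℕ}

/-! ## §1 Zero-padding along an injection `e : Fin N → Fin m` -/

/-- The padded tensor at embedded indices is the original entry. [bookkeeping] -/
theorem padTensor_apply_emb (e : Fin N → Fin m) (he : Function.Injective e) (s : Fin N → Fin N → Fin N → ℂ)
    (a b c : Fin N) : padTensor e s (e a) (e b) (e c) = s a b c := by
  unfold padTensor
  rw [Finset.sum_eq_single (a, b, c)]
  · simp
  · rintro ⟨a', b', c'⟩ _ hne
    have : ¬ (e a' = e a ∧ e b' = e b ∧ e c' = e c) := by
      rintro ⟨h1, h2, h3⟩
      exact hne (by rw [he h1, he h2, he h3])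
    rw [if_neg this, zero_mul]
  · intro hmem
    exact absurd (Finset.mem_univ _) hmem

/-- The padded tensor vanishes off the image of `e³`. [bookkeeping] -/
theorem padTensor_apply_of_not_exists (e : Fin N → Fin m) (s : Fin N → Fin N → Fin N → ℂ) (q : Idx m)
    (hq : ¬ ∃ p : Fin N × Fin N × Fin N, (e p.1, e p.2.1, e p.2.2) = q) :
    padTensor e s q.1 q.2.1 q.2.2 = 0 := by
  unfold padTensor
  refine Finset.sum_eq_zero fun p _ => ?_
  rw [if_neg, zero_mul]
  rintro ⟨h1, h2, h3⟩
  exact hq ⟨p, Prod.ext h1 (Prod.ext h2 h3)⟩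

/-- The restriction of the padded tensor back to the sub-format is the original tensor. [bookkeeping] -/
theorem padTensor_precomp_eq (e : Fin N → Fin m) (he : Function.Injective e) (s : Fin N → Fin N → Fin N → ℂ) :
    (fun a b c => padTensor e s (e a) (e b) (e c)) = s := by
  funext a b c
  exact padTensor_apply_emb e he s a b c

/-- Border rank does not drop under zero-padding: `bR(s) ≤ bR(pad_e s)` (restriction is monotone).
[cite: Blaser2013, Lemma 5.4] -/
theorem algBorderRank_le_padTensor (e : Fin N → Fin m) (he : Function.Injective e)
    (s : Fin N → Fin N → Fin N → ℂ) : algBorderRank s ≤ algBorderRank (padTensor e s) := by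
  have key := algBorderRank_precomp_le (padTensor e s) e e e
  rwa [padTensor_precomp_eq e he s] at key

/-! ## §2 The pull-back of a format-`m` polynomial to the sub-format -/

/-- Value of the pull-back: substituting `X_{e³p} ↦ X_p` and `X_q ↦ 0` off the image computes `f` at the padded tensor.
[cite: BurgisserIkenmeyer2011, §2] -/
theorem aeval_bind₁_subformatPullback (e : Fin N → Fin m) (he : Function.Injective e)
    (f : MvPolynomial (Idx m) ℂ) (s : Fin N → Fin N → Fin N → ℂ) :
    MvPolynomial.aeval (fun p : Fin N × Fin N × Fin N => s p.1 p.2.1 p.2.2)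
        (MvPolynomial.bind₁ (fun q : Idx m =>
          if h : ∃ p : Fin N × Fin N × Fin N, (e p.1, e p.2.1, e p.2.2) = q
          then MvPolynomial.X (Classical.choose h) else 0) f) =
      evalT (padTensor e s) f := by
  have hfun : (fun q : Idx m => MvPolynomial.aeval (fun p : Fin N × Fin N × Fin N => s p.1 p.2.1 p.2.2)
      ((if h : ∃ p : Fin N × Fin N × Fin N, (e p.1, e p.2.1, e p.2.2) = q
        then MvPolynomial.X (Classical.choose h) else 0 : MvPolynomial (Fin N × Fin N × Fin N) ℂ))) =
      fun q : Idx m => padTensor e s q.1 q.2.1 q.2.2 := by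
    funext q
    by_cases h : ∃ p : Fin N × Fin N × Fin N, (e p.1, e p.2.1, e p.2.2) = q
    · rw [dif_pos h, MvPolynomial.aeval_X]
      have hq : (e (Classical.choose h).1, e (Classical.choose h).2.1, e (Classical.choose h).2.2) = q :=
        Classical.choose_spec h
      have h1 : q.1 = e (Classical.choose h).1 := (congrArg Prod.fst hq).symm
      have h2 : q.2.1 = e (Classical.choose h).2.1 := (congrArg (fun r => r.2.1) hq).symm
      have h3 : q.2.2 = e (Classical.choose h).2.2 := (congrArg (fun r => r.2.2) hq).symm
      rw [h1, h2, h3]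
      exact (padTensor_apply_emb e he s _ _ _).symm
    · rw [dif_neg h, map_zero]
      exact (padTensor_apply_of_not_exists e s q h).symm
  rw [MvPolynomial.aeval_bind₁, hfun]
  rfl

/-- The pull-back does not raise the degree. [bookkeeping] -/
theorem totalDegree_subformatPullback_le (e : Fin N → Fin m) (f : MvPolynomial (Idx m) ℂ) :
    (MvPolynomial.bind₁ (fun q : Idx m =>
        if h : ∃ p : Fin N × Fin N × Fin N, (e p.1, e p.2.1, e p.2.2) = q
        then MvPolynomial.X (R := ℂ) (Classical.choose h) else 0) f).totalDegree ≤ f.totalDegree := by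
  refine totalDegree_bind₁_le_of_le_one _ (fun q => ?_) f
  by_cases h : ∃ p : Fin N × Fin N × Fin N, (e p.1, e p.2.1, e p.2.2) = q
  · rw [dif_pos h]
    exact (MvPolynomial.totalDegree_X (R := ℂ) _).le
  · rw [dif_neg h, MvPolynomial.totalDegree_zero]
    exact Nat.zero_le _

/-- A test of `σ_m` (a polynomial vanishing on the rank-`≤ m` tensors of format `m`) pulls back to a polynomial vanishing on
the rank-`≤ m` tensors of the sub-format (padding does not raise rank). [cite: Blaser2013, Lemma 5.4] -/
theorem subformatPullback_vanishing (e : Fin N → Fin m) (he : Function.Injective e)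
    {f : MvPolynomial (Idx m) ℂ} (hf : f ∈ orbitVanishing (unitTensor ℂ m))
    (u : Fin N → Fin N → Fin N → ℂ) (hu : tensorRank u ≤ m) :
    MvPolynomial.aeval (fun p : Fin N × Fin N × Fin N => u p.1 p.2.1 p.2.2)
        (MvPolynomial.bind₁ (fun q : Idx m =>
          if h : ∃ p : Fin N × Fin N × Fin N, (e p.1, e p.2.1, e p.2.2) = q
          then MvPolynomial.X (Classical.choose h) else 0) f) = 0 := by
  rw [aeval_bind₁_subformatPullback e he f u]
  exact (mem_orbitVanishing_unitTensor_iff_rank.1 hf) _ ((tensorRank_padTensor_le e u).trans hu)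

/-! ## §3 The obstruction -/

/-- A sub-format witness passes every test that its sub-format cannot see: if every degree-`≤ D` polynomial on
`(ℂ^N)^{⊗3}` vanishing on rank-`≤ m` tensors vanishes at `s₀`, then `pad_e s₀` passes every degree-`≤ D` test of `σ_m`.
[cite: BurgisserIkenmeyer2011, §3.1] -/
theorem padTensor_passesTests_of_blind (e : Fin N → Fin m) (he : Function.Injective e) {D : ℕ}
    (s₀ : Fin N → Fin N → Fin N → ℂ)
    (hblind : ∀ g : MvPolynomial (Fin N × Fin N × Fin N) ℂ, g.totalDegree ≤ D →
      (∀ u : Fin N → Fin N → Fin N → ℂ, tensorRank u ≤ m →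
        MvPolynomial.aeval (fun p : Fin N × Fin N × Fin N => u p.1 p.2.1 p.2.2) g = 0) →
      MvPolynomial.aeval (fun p : Fin N × Fin N × Fin N => s₀ p.1 p.2.1 p.2.2) g = 0) :
    ∀ f : MvPolynomial (Idx m) ℂ, f.totalDegree ≤ D → f ∈ orbitVanishing (unitTensor ℂ m) →
      evalT (padTensor e s₀) f = 0 := by
  intro f hdeg hf
  rw [← aeval_bind₁_subformatPullback e he f s₀]
  exact hblind _ ((totalDegree_subformatPullback_le e f).trans hdeg) (subformatPullback_vanishing e he hf)

/-- **The sub-format obstruction.**  If some tensor `s₀` of a sub-format `(ℂ^N)^{⊗3} ↪ (ℂ^m)^{⊗3}` has border rank `> m`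
but is annihilated by every degree-`≤ D` element of `I(σ_m((ℂ^N)^{⊗3}))`, then the degree-`≤ D` tests of
`σ_m(ℂ^m⊗ℂ^m⊗ℂ^m)` do not decide border rank `≤ m` — the cut-out degree of `σ_m` in format `m` exceeds `D`.
With `N = 7, m = 18, D = 186999` (the hypersurface `σ_18(ℂ^7⊗ℂ^7⊗ℂ^7)`, `I_{186999} = 0`, generic border rank 19) this is
`D₀(18) ≥ 187000`. [cite: LandsbergGCT2017, §8.3.2; HauensteinIkenmeyerLandsberg2013] -/
theorem not_testsDecide_of_subformatWitness (e : Fin N → Fin m) (he : Function.Injective e) {D : ℕ}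
    (s₀ : Fin N → Fin N → Fin N → ℂ) (hbr : m < algBorderRank s₀)
    (hblind : ∀ g : MvPolynomial (Fin N × Fin N × Fin N) ℂ, g.totalDegree ≤ D →
      (∀ u : Fin N → Fin N → Fin N → ℂ, tensorRank u ≤ m →
        MvPolynomial.aeval (fun p : Fin N × Fin N × Fin N => u p.1 p.2.1 p.2.2) g = 0) →
      MvPolynomial.aeval (fun p : Fin N × Fin N × Fin N => s₀ p.1 p.2.1 p.2.2) g = 0) :
    ¬ ∀ t : Tensor ℂ m,
        (∀ f : MvPolynomial (Idx m) ℂ, f.totalDegree ≤ D → f ∈ orbitVanishing (unitTensor ℂ m) → evalT t f = 0) →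
        algBorderRank t ≤ m := by
  intro H
  have h1 := H (padTensor e s₀) (padTensor_passesTests_of_blind e he s₀ hblind)
  have h2 := algBorderRank_le_padTensor e he s₀
  omega

/-- Positive form: if the degree-`≤ D` tests of `σ_m(ℂ^m⊗ℂ^m⊗ℂ^m)` decide border rank `≤ m`, then in every sub-format
every tensor of border rank `> m` is separated from `σ_m((ℂ^N)^{⊗3})` by an equation of degree `≤ D`: the separating
degree of every sub-format is a lower bound for the cut-out degree. [cite: LandsbergGCT2017, §8.3.2] -/
theorem subformatSeparates_of_testsDecide {D : ℕ}
    (H : ∀ t : Tensor ℂ m,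
      (∀ f : MvPolynomial (Idx m) ℂ, f.totalDegree ≤ D → f ∈ orbitVanishing (unitTensor ℂ m) → evalT t f = 0) →
      algBorderRank t ≤ m)
    (e : Fin N → Fin m) (he : Function.Injective e) (s₀ : Fin N → Fin N → Fin N → ℂ) (hbr : m < algBorderRank s₀) :
    ∃ g : MvPolynomial (Fin N × Fin N × Fin N) ℂ, g.totalDegree ≤ D ∧
      (∀ u : Fin N → Fin N → Fin N → ℂ, tensorRank u ≤ m →
        MvPolynomial.aeval (fun p : Fin N × Fin N × Fin N => u p.1 p.2.1 p.2.2) g = 0) ∧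
      MvPolynomial.aeval (fun p : Fin N × Fin N × Fin N => s₀ p.1 p.2.1 p.2.2) g ≠ 0 := by
  by_contra hno
  refine not_testsDecide_of_subformatWitness e he s₀ hbr (fun g hg hvan => ?_) H
  by_contra hne
  exact hno ⟨g, hg, hvan, hne⟩

/-- **Under `G₁`** (structured form): eventually in `m`, every tensor of border rank `> m` in every sub-format `N ≤ m` is
separated from `σ_m((ℂ^N)^{⊗3})` in degree `≤ m^c` — so `G₁` would bound the separating / hypersurface degrees of ALL
proper sub-format secants `σ_m(N₁,N₂,N₃)`, `N_i ≤ m`, by `m^c`; the print data (`19` at `m = 6`, `≥ 46` at `m = 15`,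
`≥ 187000` at `m = 18`) are what makes `G₁` implausible. [cite: LandsbergGCT2017, §8.3.2] -/
theorem subformatSeparates_of_secantsCutOut
    (hG : ∃ c m₀ : ℕ, ∀ m : ℕ, m₀ ≤ m → ∀ t : Tensor ℂ m,
      (∀ f : MvPolynomial (Idx m) ℂ, f.totalDegree ≤ m ^ c → f ∈ orbitVanishing (unitTensor ℂ m) → evalT t f = 0) →
      algBorderRank t ≤ m) :
    ∃ c m₀ : ℕ, ∀ m : ℕ, m₀ ≤ m → ∀ N : ℕ, ∀ e : Fin N → Fin m, Function.Injective e →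
      ∀ s₀ : Fin N → Fin N → Fin N → ℂ, m < algBorderRank s₀ →
        ∃ g : MvPolynomial (Fin N × Fin N × Fin N) ℂ, g.totalDegree ≤ m ^ c ∧
          (∀ u : Fin N → Fin N → Fin N → ℂ, tensorRank u ≤ m →
            MvPolynomial.aeval (fun p : Fin N × Fin N × Fin N => u p.1 p.2.1 p.2.2) g = 0) ∧
          MvPolynomial.aeval (fun p : Fin N × Fin N × Fin N => s₀ p.1 p.2.1 p.2.2) g ≠ 0 := by
  obtain ⟨c, m₀, h⟩ := hG
  exact ⟨c, m₀, fun m hm N e he s₀ hbr => subformatSeparates_of_testsDecide (h m hm) e he s₀ hbr⟩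

/-- **Calibration of the filed law `G₃`** (`SecantTestsSoundUpToPolyLoss`, item `stmt-MatrixMultiplication-27291`): under
`G₃`, eventually in `m`, every tensor of ANY sub-format `(ℂ^N)^{⊗3} ↪ (ℂ^m)^{⊗3}` with border rank `> m^{1+δ}` is
separated from `σ_m((ℂ^N)^{⊗3})` by an equation of degree `≤ m^c` — in particular on the sub-formats `6N − 4 ≤ m`
inside the cactus variety, where only non-determinantal equations can do it («Kumar–Volk completeness»).  The
hypersurface witnesses of §3 have border rank `≤ m + 1` and are not in the scope of this statement. [this node] -/
theorem subformatSeparates_of_secantTestsSoundUpToPolyLoss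
    (hG : Summit.MatrixMultiplication.MatrixMultiplication.Theses.ObstructionDescent.SecantTestsSoundUpToPolyLoss) :
    ∀ δ : ℝ, 0 < δ → ∃ c m₀ : ℕ, ∀ m : ℕ, m₀ ≤ m → ∀ N : ℕ, ∀ e : Fin N → Fin m, Function.Injective e →
      ∀ s₀ : Fin N → Fin N → Fin N → ℂ, (m : ℝ) ^ (1 + δ) < algBorderRank s₀ →
        ∃ g : MvPolynomial (Fin N × Fin N × Fin N) ℂ, g.totalDegree ≤ m ^ c ∧
          (∀ u : Fin N → Fin N → Fin N → ℂ, tensorRank u ≤ m →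
            MvPolynomial.aeval (fun p : Fin N × Fin N × Fin N => u p.1 p.2.1 p.2.2) g = 0) ∧
          MvPolynomial.aeval (fun p : Fin N × Fin N × Fin N => s₀ p.1 p.2.1 p.2.2) g ≠ 0 := by
  intro δ hδ
  obtain ⟨c, m₀, h⟩ := secantTestsSoundUpToPolyLoss_iff.1 hG δ hδ
  refine ⟨c, m₀, fun m hm N e he s₀ hbr => ?_⟩
  by_contra hno
  have hblind : ∀ g : MvPolynomial (Fin N × Fin N × Fin N) ℂ, g.totalDegree ≤ m ^ c →
      (∀ u : Fin N → Fin N → Fin N → ℂ, tensorRank u ≤ m →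
        MvPolynomial.aeval (fun p : Fin N × Fin N × Fin N => u p.1 p.2.1 p.2.2) g = 0) →
      MvPolynomial.aeval (fun p : Fin N × Fin N × Fin N => s₀ p.1 p.2.1 p.2.2) g = 0 := by
    intro g hg hvan
    by_contra hne
    exact hno ⟨g, hg, hvan, hne⟩
  have h1 := h m hm (padTensor e s₀) (padTensor_passesTests_of_blind e he s₀ hblind)
  have h2 : (algBorderRank s₀ : ℝ) ≤ algBorderRank (padTensor e s₀) := by
    exact_mod_cast algBorderRank_le_padTensor e he s₀
  linarith

end Summit.MatrixMultiplication.MatrixMultiplication.Theorems.ObstructionDescentSubformatObstruction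

end
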